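import Summits.KontsevichZagierPeriods.Zeta5Search.DenomLaw.OrbitCreditHMultiA
import Summits.KontsevichZagierPeriods.Zeta5Search.DenomLaw.OrbitCreditHSingle

/-!
# ζ(5) search — DENOM-LAW track D3: the H* increment — LAYER 2, multi-pole case (T) PROVED; `OrbitFloorHStar` and the (VH) unit are theorems

Sixth file of the OrbitCredit lineage (refactoring by denom-theory-d3 g5 of the seat file v6 `HOME/denom-law/code/d3g4/lean/OrbitCredit.lean`,
sha256 21381c2d…, author denom-theory-d3 g4; filed by the prover seat denom-engine-d2; tree names `LoopAndPair` / `OrbitFloorHStar`).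
`multiH_cases`: in the floor identity `multiH_key` (part A) every term is `≥ 0`; the H pair `(J, K)` of `LoopAndPair` has `b_J ≥ p`, so the class
end points `x` and `τx` avoid `B_J`; `J ∈ {j₁, j₂}` would give two block-free class points; hence the identity's unit is the pair sum over the other
blocks (if `K ∉ {j₁, j₂}`) or the cross deficit of the pole-free block `J` — in every case the class has no point besides the two poles, no pole at
the centre, no odd-centre bonus, and every block contains both poles or neither.  `multiH_credited`: so the class is `{x, τx}` with equal depths,
centre-free, frame-palindromic, of even exponent `2(1 − bc)` — credited.  `floorLayerMultiH_holds : FloorLayerMultiH`; with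
`orbitFloorHStar_of_multi` (`DenomLaw/OrbitCreditHSingle.lean`) **`orbitFloorHStar_holds : OrbitFloorHStar`**, and with `classOrbitBound_holds`
(`DenomLaw/OrbitCredit.lean`) and `vh_shape` (`DenomLaw/OrbitCreditCasoratian.lean`) the H* unit **`vh_holds`**: `v_p(V(b)) ≥ −N_p + 1` in the window
`5 ≤ p ≤ b₀ < p² − 2`, `p ≤ d < 2p`, `m₁ < 2p`, under `LoopAndPair`, whenever `VB⁺` is defined and `V(b) ≠ 0`.
HONEST FRAMING: systematic search; a p-adic valuation bound on the rational numbers V(b) of the cell's dual linear forms from a digit-free counting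
statement and the tree's class bounds; MODEL-side it is the sealed H* unit of SYMMETRY-D3 §8.6–8.9 whose exactness rates are MODEL data; nothing
about ζ(5); no γ moves; no irrationality claim; records in print UNMOVED.
-/

open Finset
open Summit.KontsevichZagierPeriods.Zeta5Search.WedgeDictionary (coeffV pfData dOf)
open Summit.KontsevichZagierPeriods.Zeta5Search.CasoratianValuation (InPolytope pairFloors shift casoratian)

namespace Summit.KontsevichZagierPeriods.Zeta5Search.ClusterValuation.Orbit

open Summit.KontsevichZagierPeriods.Zeta5Search.ClusterValuation
open Summit.KontsevichZagierPeriods.Zeta5Search.PadicSeries (one_le_p zpow_p_nonneg)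
open Summit.KontsevichZagierPeriods.Zeta5Search.DualSeries (InBox)
open Summit.KontsevichZagierPeriods.Zeta5Search.BigPrime (shift_zero dOf_shift)

/-! ### Case (T): the H pair forces balance -/

/-- **The H pair forces balance** (SYMMETRY-D3 §9.9.4, case (T)).  In the floor identity `multiH_key` every term is `≥ 0` (`crossDef_nonneg`).
The H pair `(J, K)` has `b_J ≥ p`, so `x ∉ B_J` and `τx ∉ B_J` (`τx + p > b₀`); `J ∈ {j₁, j₂}` would make `x ≠ q` and `τx ≠ q'` two block-free
class points (`#Z ≥ 2 > 1`); so `J ∉ {j₁, j₂}` and the unit of the identity is the pair sum `ρ ≥ pT(J,K) ≥ 1` if `K ∉ {j₁, j₂}`, else the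
cross deficit of `J` (`≥ pT(j₁,J) + pT(j₂,J) ≥ 1`, with `B_J` pole-free: a pole in `B_J` gives a block-free class point AND a positive deficit).
OUTCOME: no class point besides the poles, no pole at the centre, no odd-centre bonus, and every other block contains both poles or neither. -/
theorem multiH_cases (b : ℕ → ℤ) (hb : InPolytope b) {p x q q' j₁ j₂ T : ℕ} (hp : 0 < p) (hpb : (p : ℤ) ≤ b 0) (hx : x < p)
    (hH : LoopAndPair b p) (hqmem : q ∈ classSet b p x) (hq'mem : q' ∈ classSet b p x) (hlt : q < q')
    (hj₁ : j₁ < 7) (hj₂ : j₂ < 7) (hq1 : q ∈ blk b j₁) (hq2 : q ∈ blk b j₂) (hq'1 : q' ∈ blk b j₁) (hq'2 : q' ∈ blk b j₂)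
    (hqq' : q + p ≤ q') (hT : (b 0).toNat - ((b 0).toNat - x) % p = T)
    (key : ∑ k ∈ ((range 7).erase j₁).erase j₂, crossDef b p j₁ j₂ q q' k + (if 2 * (q : ℤ) = b 0 then (1 : ℤ) else 0) +
      (if 2 * (q' : ℤ) = b 0 then (1 : ℤ) else 0) + ((((classSet b p x).erase q).erase q').card : ℤ) +
      (if ¬ (2 : ℤ) ∣ b 0 ∧ CentreIn b p x then (1 : ℤ) else 0) + pairSum b p (((range 7).erase j₁).erase j₂) = 1) :
    ((((classSet b p x).erase q).erase q').card : ℤ) = 0 ∧ (if 2 * (q : ℤ) = b 0 then (1 : ℤ) else 0) = 0 ∧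
      (if 2 * (q' : ℤ) = b 0 then (1 : ℤ) else 0) = 0 ∧ (if ¬ (2 : ℤ) ∣ b 0 ∧ CentreIn b p x then (1 : ℤ) else 0) = 0 ∧
      ∀ k ∈ ((range 7).erase j₁).erase j₂, (q ∈ blk b k ↔ q' ∈ blk b k) := by
  have hp' : (0 : ℤ) < (p : ℤ) := by exact_mod_cast hp
  have h0 : 0 ≤ b 0 := hb.1.1
  have hb0 : (((b 0).toNat : ℕ) : ℤ) = b 0 := Int.toNat_of_nonneg h0
  set R := ((range 7).erase j₁).erase j₂ with hR
  set Z := ((classSet b p x).erase q).erase q' with hZ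
  set D := ∑ k ∈ R, crossDef b p j₁ j₂ q q' k with hD
  have hRsub : R ⊆ range 7 := (erase_subset _ _).trans (erase_subset _ _)
  have memR : ∀ k, k ∈ R ↔ k < 7 ∧ k ≠ j₁ ∧ k ≠ j₂ := by
    intro k; rw [hR, mem_erase, mem_erase, mem_range]
    exact ⟨fun h => ⟨h.2.2, h.2.1, h.1⟩, fun h => ⟨h.2.2, h.2.1, h.1⟩⟩
  have memZ : ∀ s, s ∈ Z ↔ s ∈ classSet b p x ∧ s ≠ q ∧ s ≠ q' := by
    intro s; rw [hZ, mem_erase, mem_erase]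
    exact ⟨fun h => ⟨h.2.2, h.2.1, h.1⟩, fun h => ⟨h.2.2, h.2.1, h.1⟩⟩
  -- the class end points `x` (least) and `T = τ x` (largest)
  obtain ⟨hxmem, hxle⟩ := self_mem_classSet_min b hpb hx
  obtain ⟨hTmem, hTge, hTgt⟩ := classTop_spec b hp hpb hx hT
  have hxq' : x ≠ q' := by have := hxle q hqmem; omega
  have hTq : T ≠ q := by have := hTge q' hq'mem; omega
  have hxT : x ≠ T := by have := hTge q' hq'mem; have := hxle q hqmem; omega
  -- every term of `key` is `≥ 0`
  have hDterm : ∀ k ∈ R, 0 ≤ crossDef b p j₁ j₂ q q' k := fun k hk =>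
    crossDef_nonneg b hb hp hj₁ hj₂ (mem_range.1 (hRsub hk)) hq1 hq2 hq'1 hq'2 hqq'
  have hD0 : 0 ≤ D := sum_nonneg hDterm
  have hDk : ∀ k ∈ R, crossDef b p j₁ j₂ q q' k ≤ D := fun k hk => single_le_sum hDterm hk
  have hzq0 : (0 : ℤ) ≤ (if 2 * (q : ℤ) = b 0 then (1 : ℤ) else 0) := by split_ifs <;> norm_num
  have hzq'0 : (0 : ℤ) ≤ (if 2 * (q' : ℤ) = b 0 then (1 : ℤ) else 0) := by split_ifs <;> norm_num
  have hbonus0 : (0 : ℤ) ≤ (if ¬ (2 : ℤ) ∣ b 0 ∧ CentreIn b p x then (1 : ℤ) else 0) := by split_ifs <;> norm_num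
  have hρ0 : 0 ≤ pairSum b p R := pairSum_nonneg b hb p hRsub
  have hκ0 : (0 : ℤ) ≤ (Z.card : ℤ) := Nat.cast_nonneg _
  have hd2 : ∀ k ∈ R, (q ∈ blk b k ∨ q' ∈ blk b k) → 2 ≤ pairTerm b p j₁ k + pairTerm b p j₂ k := fun k hk hor =>
    two_le_cross b hb hp hj₁ hj₂ (mem_range.1 (hRsub hk)) hq1 hq2 hq'1 hq'2 hqq' hor
  have hbal : ∀ k ∈ R, crossDef b p j₁ j₂ q q' k = 0 → (q ∈ blk b k ↔ q' ∈ blk b k) := fun k hk h =>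
    crossDef_eq_zero b hb hp hj₁ hj₂ (mem_range.1 (hRsub hk)) hq1 hq2 hq'1 hq'2 hqq' h
  have hnn : ∀ k ∈ R, 0 ≤ pairTerm b p j₁ k ∧ 0 ≤ pairTerm b p j₂ k := fun k hk =>
    ⟨pairTerm_nonneg b hb p hj₁ (mem_range.1 (hRsub hk)), pairTerm_nonneg b hb p hj₂ (mem_range.1 (hRsub hk))⟩
  -- the H pair `(J, K)` (0-based), `b_J ≥ p`: `x, T ∉ B_J`
  obtain ⟨j, hj, hloop, k, hk, hkj, hpair⟩ := hH
  rw [Finset.mem_Icc] at hj hk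
  obtain ⟨hj1, hj7⟩ := hj
  obtain ⟨hk1, hk7⟩ := hk
  obtain ⟨J, hJj⟩ : ∃ J, J + 1 = j := ⟨j - 1, by omega⟩
  obtain ⟨K, hKk⟩ : ∃ K, K + 1 = k := ⟨k - 1, by omega⟩
  have hJ7 : J < 7 := by omega
  have hK7 : K < 7 := by omega
  have hJK : J ≠ K := by omega
  have hβJ : 0 ≤ b (J + 1) := (hb.1.2 J (mem_range.2 hJ7)).1
  have hbJ : (((b (J + 1)).toNat : ℕ) : ℤ) = b (J + 1) := Int.toNat_of_nonneg hβJ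
  have hloopJ : (p : ℤ) ≤ b (J + 1) := by rw [hJj]; exact hloop
  have hJKterm : 1 ≤ pairTerm b p J K := by
    unfold pairTerm; rw [hJj, hKk]; exact Int.le_ediv_of_mul_le hp' (by linarith only [hpair])
  have hKJterm : 1 ≤ pairTerm b p K J := by rw [pairTerm_comm]; exact hJKterm
  have hpJ : p ≤ (b (J + 1)).toNat := by
    have h3 : ((p : ℕ) : ℤ) ≤ (((b (J + 1)).toNat : ℕ) : ℤ) := by rw [hbJ]; exact hloopJ
    exact_mod_cast h3
  have hxJ : x ∉ blk b J := by
    intro h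
    have h1 := ((mem_blk b J x).1 h).1
    omega
  have hTJ : T ∉ blk b J := by
    intro h
    have h2' := ((mem_blk b J T).1 h).2
    omega
  have hxZ : x ≠ q → x ∈ Z := fun h => (memZ x).2 ⟨hxmem, h, hxq'⟩
  have hTZ : T ≠ q' → T ∈ Z := fun h => (memZ T).2 ⟨hTmem, hTq, h⟩
  have hZ2 : x ∈ Z → T ∈ Z → (2 : ℤ) ≤ (Z.card : ℤ) := by
    intro h1 h2'
    have h3 : 1 < Z.card := one_lt_card.2 ⟨x, h1, T, h2', hxT⟩
    have h4 : 2 ≤ Z.card := h3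
    exact_mod_cast h4
  have hZ1 : ∀ s ∈ Z, (1 : ℤ) ≤ (Z.card : ℤ) := by
    intro s hs
    have h3 : 0 < Z.card := card_pos.2 ⟨s, hs⟩
    have h4 : 1 ≤ Z.card := h3
    exact_mod_cast h4
  -- (α) `J` is not one of the two largest blocks (else `x` and `T` are two block-free class points)
  have hJ1 : J ≠ j₁ := by
    intro hJe
    have hx' : x ∈ Z := hxZ (fun h => hxJ (by rw [hJe, h]; exact hq1))
    have hT' : T ∈ Z := hTZ (fun h => hTJ (by rw [hJe, h]; exact hq'1))
    have h5 := hZ2 hx' hT'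
    linarith only [key, hD0, hzq0, hzq'0, hbonus0, hρ0, h5]
  have hJ2 : J ≠ j₂ := by
    intro hJe
    have hx' : x ∈ Z := hxZ (fun h => hxJ (by rw [hJe, h]; exact hq2))
    have hT' : T ∈ Z := hTZ (fun h => hTJ (by rw [hJe, h]; exact hq'2))
    have h5 := hZ2 hx' hT'
    linarith only [key, hD0, hzq0, hzq'0, hbonus0, hρ0, h5]
  have hJR : J ∈ R := (memR J).2 ⟨hJ7, hJ1, hJ2⟩
  -- (β) where the unit of the identity goes
  by_cases hKR : K ∈ R
  · -- the H pair avoids `j₁, j₂`: it is the unit (`ρ ≥ 1`)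
    have hρ1 : 1 ≤ pairSum b p R := by
      rcases lt_or_gt_of_ne hJK with h | h
      · exact le_trans hJKterm (pairTerm_le_pairSum b hb p hRsub hJR hKR h)
      · exact le_trans hKJterm (pairTerm_le_pairSum b hb p hRsub hKR hJR h)
    have hD' : D = 0 := by linarith only [key, hD0, hzq0, hzq'0, hbonus0, hκ0, hρ1]
    refine ⟨by linarith only [key, hD0, hzq0, hzq'0, hbonus0, hκ0, hρ1],
      by linarith only [key, hD0, hzq0, hzq'0, hbonus0, hκ0, hρ1],
      by linarith only [key, hD0, hzq0, hzq'0, hbonus0, hκ0, hρ1],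
      by linarith only [key, hD0, hzq0, hzq'0, hbonus0, hκ0, hρ1], fun k hk => hbal k hk ?_⟩
    have h1 := hDk k hk
    have h2' := hDterm k hk
    linarith only [h1, h2', hD']
  · have hK12 : K = j₁ ∨ K = j₂ := by
      by_contra h
      push Not at h
      exact hKR ((memR K).2 ⟨hK7, h.1, h.2⟩)
    have hsum1 : 1 ≤ pairTerm b p j₁ J + pairTerm b p j₂ J := by
      obtain ⟨hn1, hn2'⟩ := hnn J hJR
      rcases hK12 with hK1 | hK2
      · rw [hK1] at hKJterm; linarith only [hKJterm, hn2']
      · rw [hK2] at hKJterm; linarith only [hKJterm, hn1]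
    by_cases hqJ : q ∈ blk b J
    · exfalso
      have hx' : x ∈ Z := hxZ (fun h => hxJ (by rw [h]; exact hqJ))
      by_cases hq'J : q' ∈ blk b J
      · have hT' : T ∈ Z := hTZ (fun h => hTJ (by rw [h]; exact hq'J))
        have h5 := hZ2 hx' hT'
        linarith only [key, hD0, hzq0, hzq'0, hbonus0, hρ0, h5]
      · have hdJ := hDk J hJR
        unfold crossDef at hdJ
        rw [if_pos hqJ, if_neg hq'J] at hdJ
        have hA := hd2 J hJR (Or.inl hqJ)
        have hB := hZ1 x hx'
        linarith only [key, hzq0, hzq'0, hbonus0, hρ0, hdJ, hA, hB]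
    · by_cases hq'J : q' ∈ blk b J
      · exfalso
        have hT' : T ∈ Z := hTZ (fun h => hTJ (by rw [h]; exact hq'J))
        have hdJ := hDk J hJR
        unfold crossDef at hdJ
        rw [if_neg hqJ, if_pos hq'J] at hdJ
        have hA := hd2 J hJR (Or.inr hq'J)
        have hB := hZ1 T hT'
        linarith only [key, hzq0, hzq'0, hbonus0, hρ0, hdJ, hA, hB]
      · -- the cross deficit of the pole-free block `J` is the unit (`d_J = 1`)
        have hdJ := hDk J hJR
        unfold crossDef at hdJ
        rw [if_neg hqJ, if_neg hq'J] at hdJ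
        have hD1 : 1 ≤ D := by linarith only [hdJ, hsum1]
        have hDle1 : D ≤ 1 := by linarith only [key, hzq0, hzq'0, hbonus0, hκ0, hρ0]
        refine ⟨by linarith only [key, hD1, hzq0, hzq'0, hbonus0, hκ0, hρ0],
          by linarith only [key, hD1, hzq0, hzq'0, hbonus0, hκ0, hρ0],
          by linarith only [key, hD1, hzq0, hzq'0, hbonus0, hκ0, hρ0],
          by linarith only [key, hD1, hzq0, hzq'0, hbonus0, hκ0, hρ0], fun k hk => ?_⟩
        by_cases hkJ : k = J
        · rw [hkJ]; exact ⟨fun h => absurd h hqJ, fun h => absurd h hq'J⟩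
        · have hDsplit : D = crossDef b p j₁ j₂ q q' J + ∑ i ∈ R.erase J, crossDef b p j₁ j₂ q q' i := by
            rw [hD]; exact (add_sum_erase R _ hJR).symm
          have hcJ : crossDef b p j₁ j₂ q q' J = pairTerm b p j₁ J + pairTerm b p j₂ J := by
            unfold crossDef; rw [if_neg hqJ, if_neg hq'J]; ring
          have hkmem : k ∈ R.erase J := mem_erase.2 ⟨hkJ, hk⟩
          have hrest := single_le_sum (f := crossDef b p j₁ j₂ q q') (fun i hi => hDterm i (mem_of_mem_erase hi)) hkmem
          have h6 := hDterm k hk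
          apply hbal k hk
          linarith only [hDsplit, hcJ, hsum1, hrest, h6, hDle1]

/-- **Case (T) for an ordered pair of poles**: the class of `x` is `{q, q'} = {x, τx}` with equal depths and no centre, hence credited
(not a single-pole class; centre-free; `τ` swaps two points of equal net exponent; `E = 2(1 − bc q)` is even). -/
theorem multiH_credited (b : ℕ → ℤ) (hb : InPolytope b) {p x q q' : ℕ} (hprime : p.Prime) (hp5 : 5 ≤ p) (hpb : (p : ℤ) ≤ b 0)
    (hx : x < p) (hm1 : mOne b < 2 * (p : ℤ)) (hH : LoopAndPair b p) (h2 : 2 ≤ classPoleCount b p x)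
    (hqmem : q ∈ classSet b p x) (hqneg : netExp b q < 0) (hq'mem : q' ∈ classSet b p x) (hq'neg : netExp b q' < 0)
    (hlt : q < q') (hE : classExp b p x = -pairFloors b p) : Credited b p x := by
  have hp0 : 0 < p := hprime.pos
  have h0 : 0 ≤ b 0 := hb.1.1
  have hb0 : (((b 0).toNat : ℕ) : ℤ) = b 0 := Int.toNat_of_nonneg h0
  obtain ⟨j₁, hj₁, j₂, hj₂, hmin₁, hmin₂⟩ := exists_two_largest b
  have hj₁7 := mem_range.1 hj₁
  have hj₂7 := mem_range.1 (mem_erase.1 hj₂).2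
  obtain ⟨⟨hq1, hq2, hq'1, hq'2⟩, hqq', hpt, hrest⟩ :=
    multiH_structure b hb hp0 hm1 hqmem hqneg hq'mem hq'neg hlt hj₁ hj₂ hmin₁ hmin₂
  have hnet1 : ∀ s ∈ classSet b p x, s ≠ q → s ≠ q' → netExp b s = 1 := fun s hs h1 h2' => (hrest s hs h1 h2').2
  obtain ⟨T, hTdef⟩ : ∃ T, (b 0).toNat - ((b 0).toNat - x) % p = T := ⟨_, rfl⟩
  obtain ⟨hxmem, hxle⟩ := self_mem_classSet_min b hpb hx
  obtain ⟨hTmem, hTge, -⟩ := classTop_spec b hp0 hpb hx hTdef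
  have key := multiH_key b hj₁ hj₂ hq1 hq2 hq'1 hq'2 hpt hqmem hq'mem hlt hnet1 hE
  obtain ⟨hZ0, hzq, hzq', hbon, hbalR⟩ :=
    multiH_cases b hb hp0 hpb hx hH hqmem hq'mem hlt hj₁7 hj₂7 hq1 hq2 hq'1 hq'2 hqq' hTdef key
  -- the class is `{q, q'}`, `x = q`, `T = q'`; no centre; equal depths
  have hZe : ((classSet b p x).erase q).erase q' = ∅ := card_eq_zero.1 (by exact_mod_cast hZ0)
  have hcls : ∀ s ∈ classSet b p x, s = q ∨ s = q' := by
    intro s hs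
    by_contra h
    push Not at h
    have hsZ : s ∈ ((classSet b p x).erase q).erase q' := mem_erase.2 ⟨h.2, mem_erase.2 ⟨h.1, hs⟩⟩
    rw [hZe] at hsZ
    simp at hsZ
  have hxq : x = q := by
    rcases hcls x hxmem with h | h
    · exact h
    · exact absurd h (by have := hxle q hqmem; omega)
  have hTq' : T = q' := by
    rcases hcls T hTmem with h | h
    · exact absurd h (by have := hTge q' hq'mem; omega)
    · exact h
  have hqc : ¬ 2 * (q : ℤ) = b 0 := fun h => by rw [if_pos h] at hzq; exact one_ne_zero hzq
  have hq'c : ¬ 2 * (q' : ℤ) = b 0 := fun h => by rw [if_pos h] at hzq'; exact one_ne_zero hzq'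
  have hbonus : ¬ (¬ (2 : ℤ) ∣ b 0 ∧ CentreIn b p x) := fun h => by rw [if_pos h] at hbon; exact one_ne_zero hbon
  have hαβ : (blockCount b q : ℤ) = blockCount b q' := by
    rw [blockCount_eq_two_add b hj₁ hj₂ hq1 hq2, blockCount_eq_two_add b hj₁ hj₂ hq'1 hq'2]
    congr 1
    refine sum_congr rfl fun k hk => ?_
    by_cases h : q ∈ blk b k
    · rw [if_pos h, if_pos ((hbalR k hk).1 h)]
    · rw [if_neg h, if_neg (fun h' => h ((hbalR k hk).2 h'))]
  have eq_q : netExp b q = 1 - (blockCount b q : ℤ) + (if 2 * (q : ℤ) = b 0 then (1 : ℤ) else 0) := rfl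
  have eq_q' : netExp b q' = 1 - (blockCount b q' : ℤ) + (if 2 * (q' : ℤ) = b 0 then (1 : ℤ) else 0) := rfl
  have hnq : netExp b q = 1 - (blockCount b q : ℤ) := by rw [eq_q, if_neg hqc, add_zero]
  have hnq' : netExp b q' = 1 - (blockCount b q : ℤ) := by rw [eq_q', if_neg hq'c, add_zero, hαβ]
  have hq'e : q' ∈ (classSet b p x).erase q := mem_erase.2 ⟨by omega, hq'mem⟩
  have hEdec : ∑ s ∈ classSet b p x, netExp b s =
      netExp b q + (netExp b q' + ∑ s ∈ ((classSet b p x).erase q).erase q', netExp b s) := by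
    rw [add_sum_erase _ _ hq'e, add_sum_erase _ _ hqmem]
  refine ⟨fun h => by have := h.1; omega, ?_, ?_, ?_⟩
  · -- not self-conjugate: an even centre would be a class point, i.e. a pole, excluded by `z = 0`; an odd one by the vanishing bonus
    intro hc
    by_cases h2' : (2 : ℤ) ∣ b 0
    · obtain ⟨m, hm⟩ := h2'
      have hm0 : 0 ≤ m := by omega
      obtain ⟨c, hcdef⟩ : ∃ c : ℕ, m.toNat = c := ⟨_, rfl⟩
      have hcm : ((c : ℕ) : ℤ) = m := by rw [← hcdef]; exact Int.toNat_of_nonneg hm0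
      have hcc : 2 * (c : ℤ) = b 0 := by rw [hcm, hm]
      have hcmem : c ∈ classSet b p x := by
        unfold classSet
        rw [mem_filter, mem_range]
        refine ⟨by omega, ?_⟩
        unfold CentreIn at hc
        have hdvd : (p : ℤ) ∣ 2 * ((x : ℤ) - c) := by rw [mul_sub, hcc]; exact hc
        have hp2 : ¬ (p : ℤ) ∣ 2 := by
          intro h
          have h7 := Int.le_of_dvd (by norm_num) h
          have h8 : (5 : ℤ) ≤ (p : ℤ) := by exact_mod_cast hp5
          omega
        have hpr : Prime (p : ℤ) := Nat.prime_iff_prime_int.1 hprime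
        have hdvd' : (p : ℤ) ∣ (x : ℤ) - c := by
          rcases hpr.dvd_or_dvd hdvd with h | h
          · exact absurd h hp2
          · exact h
        have hmod : (c : ℤ) ≡ (x : ℤ) [ZMOD (p : ℤ)] := Int.modEq_iff_dvd.2 hdvd'
        exact Int.natCast_modEq_iff.1 hmod
      rcases hcls c hcmem with h | h
      · rw [h] at hcc; exact hqc hcc
      · rw [h] at hcc; exact hq'c hcc
    · exact hbonus ⟨h2', hc⟩
  · -- frame-palindromic: `τ` swaps `q = x` and `q' = τx`, which have the same net exponent
    intro s hs
    rw [hTdef]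
    rcases hcls s hs with hs' | hs'
    · rw [hs', ← hxq, Nat.sub_self, Nat.sub_zero, hTq', hxq, hnq, hnq']
    · rw [hs', hTq', hxq, Nat.sub_sub_self hlt.le, hnq, hnq']
  · -- even exponent `E = 2 (1 − bc q)`
    have : classExp b p x = 2 * (1 - (blockCount b q : ℤ)) := by
      unfold classExp
      rw [hEdec, hZe, sum_empty, if_neg hbonus, hnq, hnq']
      ring
    rw [this]
    exact even_two_mul _

/-- **LAYER 2, multi-pole case (T) holds** (`FloorLayerMultiH` of `DenomLaw/OrbitCreditHLayers.lean`): a class with `≥ 2` poles at the floor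
`E_x = −N_p`, under LoopAndPair in the first period of the one-carry regime, is credited.  (The `d`-window and `b₀ < p² − 2` hypotheses are unused.) -/
theorem floorLayerMultiH_holds : FloorLayerMultiH := by
  intro b p x hb hprime hp5 hpb _hwin _hd1 _hd2 hm1 hH hx h2 hE
  obtain ⟨q₁, hq₁, q₂, hq₂, hqne⟩ := one_lt_card.1 (by unfold classPoleCount at h2; omega :
    1 < ((classSet b p x).filter fun s => netExp b s < 0).card)
  rw [mem_filter] at hq₁ hq₂
  rcases lt_or_gt_of_ne hqne with h | h
  · exact multiH_credited b hb hprime hp5 hpb hx hm1 hH h2 hq₁.1 hq₁.2 hq₂.1 hq₂.2 h hE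
  · exact multiH_credited b hb hprime hp5 hpb hx hm1 hH h2 hq₂.1 hq₂.2 hq₁.1 hq₁.2 h hE

/-- **`OrbitFloorHStar` is a theorem**: Layer 1 = `noExtremalUnderH_holds`, Layer 2 = `floorLayerSingleH_holds` ∧ `floorLayerMultiH_holds`. -/
theorem orbitFloorHStar_holds : OrbitFloorHStar := orbitFloorHStar_of_multi floorLayerMultiH_holds

/-- **The H* unit (VH) is a tree theorem** — `ClassOrbitBound` (`classOrbitBound_holds`) ∧ `OrbitFloorHStar` (`orbitFloorHStar_holds`) via
`vh_shape`: in the window `5 ≤ p ≤ b₀ < p² − 2`, one-carry regime `p ≤ d < 2p`, first period `m₁ < 2p`, under `LoopAndPair` (some vertex with a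
large loop AND a large pair through it), `v_p(V(b)) ≥ −N_p + 1` whenever `VB⁺` is defined and `V(b) ≠ 0`.  A digit-free counting statement plus the
tree's class bounds; MODEL-side it is the sealed H* unit of SYMMETRY-D3 §8.6–8.9 (exactness rates there are MODEL data); no γ moves; nothing about ζ(5). -/
theorem vh_holds :
    ∀ (b : ℕ → ℤ) (p : ℕ) (v : ℤ), InPolytope b → p.Prime → 5 ≤ p → (p : ℤ) ≤ b 0 → (b 0 + 2 : ℤ) < (p : ℤ) ^ 2 →
      (p : ℤ) ≤ dOf b → dOf b < 2 * (p : ℤ) → mOne b < 2 * (p : ℤ) → LoopAndPair b p →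
        vbPlus b p = some v → coeffV b ≠ 0 → ((-pairFloors b p + 1 : ℤ) : ℚ) ≤ (padicValRat p (coeffV b) : ℚ) :=
  vh_shape classOrbitBound_holds orbitFloorHStar_holds

end Summit.KontsevichZagierPeriods.Zeta5Search.ClusterValuation.Orbit
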